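import Mathlib
import HarnessLib

/-!
# Enflo 2023, v2 p.13 (27), Case II: the referee's competitor move — the printed justification does not follow

Source under adjudication: Per H. Enflo, *On the invariant subspace problem in Hilbert spaces*, arXiv:2305.15442 (v1
2023, v2 2024), bib key `Enflo2023` — a CLAIMED proof of the invariant subspace problem for operators on a separable
Hilbert space.  This file is part of the kernel-tight typing of the manuscript by the b2b-enflo repair cell (the
REFEREE seat's independent record, unit b2b-enflo-3; formaliser 1's `CaseII.lean` reaches the same step from the
minimiser's side).  NOTHING here asserts that the manuscript's main theorem holds, and nothing here is a theorem OF
the manuscript: the file REFUTES the printed justification of one inference.  Value (BLOCK-2b): theorems /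
refutations of typed inferences about a text — not progress on the problem.

Setting of the paper, v2 p.13: `y'₁` is the output of a minimal move (so (9) holds for it),
`εθ = ⟨y'₁, x₀ − y'₁⟩ > 0`, and we are in **Case II**: `|⟨T^j y'₁, x₀ − y'₁⟩| < (εθ)⁴` for all `j ≥ 1`.
With `δ = εθ/10` the paper takes `ℓ'` of minimal `ℓ²`-norm with
`‖x₀ − ℓ'(T) y'₁‖ ≤ ‖x₀ − (1+δ) y'₁‖` (26) and claims (27): `‖ℓ'(T) y'₁ − (1+δ) y'₁‖ < (εθ)²`,
justified by the sentence

> "if `|a₀| < 1 + δ − (εθ)²` then, to fulfill (26), we would need `|a_j| ≥ 1` for some `j ≥ 1`."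

This file exhibits a coefficient vector with `a₀ = 1 + δ − 1.01 (εθ)²`, a single further coefficient
`|a_j| = 1.4 εθ` (so `|a_j| ≪ 1`), and every other coefficient `0`, which has `ℓ²`-norm `< 1 + δ`
and lands **strictly inside** the ball of (26).  The only input is the quantity
`κ_j = |⟨y'₁, T^j y'₁⟩|` — which Case II does not control — together with `εθ ≤ κ_j/10`.
In the notation below: `r = x₀ − (1+δ) y'₁`, `y = y'₁`, `w = e^{iφ} T^j y'₁` with the phase `φ` chosen
so that `⟨r, w⟩` is real and `≥ δ κ_j − (εθ)⁴` (the Case II bound on `⟨x₀ − y'₁, T^j y'₁⟩` and the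
uncontrolled term `−δ ⟨y'₁, T^j y'₁⟩`).  The competitor is `V a = (1+δ−σ) y'₁ + β w`, so that
`x₀ − V a = r + σ y − β w`.  (The bound `‖w‖ ≤ 10⁻²⁰` is the paper's standing normalisation `‖T‖ ≤ 10⁻²⁰`, v2 p.2.)
What this does NOT say: it does not compute the minimiser of (26); the complementary statement that the minimiser
itself moves by `≳ 0.1 κ₁ τ₁` is formaliser 1's `CaseII.eq27_false_in_window`.
STATUS: CLOSED (zero sorry); axioms `[propext, Classical.choice, Quot.sound]`.
Origin: referee-b2b-enflo-3-0 (2026-08-18), staged from the cell package `EnfloISP/Referee/Gap.lean` unchanged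
except for the namespace and the provenance tags.
-/

open scoped InnerProductSpace

namespace Literature.Analysis.OperatorTheory.Enflo2023.Referee

variable {H : Type*} [NormedAddCommGroup H] [InnerProductSpace ℂ H]

/-- Expansion of `‖r + σ y − β w‖²` for real scalars `σ, β`. [folklore] -/
lemma norm_add_smul_sub_smul_sq (r y w : H) (σ β : ℝ) :
    ‖r + (σ : ℂ) • y - (β : ℂ) • w‖ ^ 2 =
      ‖r‖ ^ 2 + σ ^ 2 * ‖y‖ ^ 2 + β ^ 2 * ‖w‖ ^ 2 + 2 * σ * (⟪r, y⟫_ℂ).re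
        - 2 * β * (⟪r, w⟫_ℂ).re - 2 * σ * β * (⟪y, w⟫_ℂ).re := by
  rw [@norm_sub_sq ℂ, @norm_add_sq ℂ]
  simp only [inner_add_left, inner_smul_left, inner_smul_right, norm_smul, Complex.norm_real,
    Real.norm_eq_abs, RCLike.re_to_complex, Complex.conj_ofReal, Complex.add_re, Complex.mul_re,
    Complex.ofReal_re, Complex.ofReal_im, mul_pow, sq_abs]
  ring

/-- The scalar inequality behind the competitor, isolated: with `A = ‖y‖² ≤ 1`, `B = ‖w‖² ≤ 10⁻⁴⁰`,
`p = Re⟨r,y⟩ ≤ εθ`, `q = Re⟨r,w⟩ ≥ δκ − (εθ)⁴`, `|s| = |Re⟨y,w⟩| ≤ κ`, the expansion is negative. [cite: Enflo2023, v2 p.13 (26)–(27)] -/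
lemma competitor_scalar (et κ A B p q s : ℝ) (het : 0 < et) (hetκ : et ≤ κ / 10)
    (hκlo : 1 / 10 ^ 37 ≤ κ) (hκhi : κ ≤ 1 / 10) (hA : A ≤ 1)
    (hB : B ≤ (1 / 10 ^ 20) ^ 2) (hp : p ≤ et) (hq : et / 10 * κ - et ^ 4 ≤ q)
    (hs : |s| ≤ κ) :
    (1.01 * et ^ 2) ^ 2 * A + (1.4 * et) ^ 2 * B + 2 * (1.01 * et ^ 2) * p
      - 2 * (1.4 * et) * q - 2 * (1.01 * et ^ 2) * (1.4 * et) * s < 0 := by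
  have hκ0 : 0 < κ := lt_of_lt_of_le (by norm_num) hκlo
  have hs' : -κ ≤ s := (abs_le.1 hs).1
  have hσ : 0 ≤ 1.01 * et ^ 2 := by positivity
  have hβ : 0 ≤ 1.4 * et := by positivity
  have h1 : (1.01 * et ^ 2) ^ 2 * A ≤ (1.01 * et ^ 2) ^ 2 :=
    mul_le_of_le_one_right (sq_nonneg _) hA
  have h2 : (1.4 * et) ^ 2 * B ≤ (1.4 * et) ^ 2 * (1 / 10 ^ 20) ^ 2 :=
    mul_le_mul_of_nonneg_left hB (sq_nonneg _)
  have h3 : 2 * (1.01 * et ^ 2) * p ≤ 2 * (1.01 * et ^ 2) * et :=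
    mul_le_mul_of_nonneg_left hp (by positivity)
  have h4 : 2 * (1.4 * et) * (et / 10 * κ - et ^ 4) ≤ 2 * (1.4 * et) * q :=
    mul_le_mul_of_nonneg_left hq (by positivity)
  have h5 : 2 * (1.01 * et ^ 2) * (1.4 * et) * (-κ) ≤ 2 * (1.01 * et ^ 2) * (1.4 * et) * s :=
    mul_le_mul_of_nonneg_left hs' (by positivity)
  -- the polynomial part, after dividing by et² > 0
  have e1 : 2.02 * et ≤ 0.202 * κ := by linarith
  have e2 : et ^ 2 ≤ (κ / 10) ^ 2 := pow_le_pow_left₀ het.le hetκ 2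
  have e2' : κ * κ ≤ κ * (1 / 10) := mul_le_mul_of_nonneg_left hκhi hκ0.le
  have e3 : et ^ 3 ≤ (κ / 10) ^ 3 := pow_le_pow_left₀ het.le hetκ 3
  have e3' : κ * κ * κ ≤ κ * (1 / 10) * (1 / 10) := by
    have := mul_le_mul_of_nonneg_right e2' hκ0.le
    have h' : κ * (1 / 10) * κ ≤ κ * (1 / 10) * (1 / 10) :=
      mul_le_mul_of_nonneg_left hκhi (by positivity)
    linarith
  have e4 : et * κ ≤ κ / 10 * κ := mul_le_mul_of_nonneg_right hetκ hκ0.le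
  have e5 : (1.96 : ℝ) / 10 ^ 40 < 0.0487 * κ := by
    have : (1.96 : ℝ) / 10 ^ 40 < 0.0487 * (1 / 10 ^ 37) := by norm_num
    linarith
  have hsub : 1.0201 * et ^ 2 + 1.96 / 10 ^ 40 + 2.02 * et + 2.8 * et ^ 3 + 2.828 * (et * κ)
      - 0.28 * κ < 0 := by
    have t2 : (κ / 10) ^ 2 = κ * κ / 100 := by ring
    have t3 : (κ / 10) ^ 3 = κ * κ * κ / 1000 := by ring
    rw [t2] at e2
    rw [t3] at e3
    linarith
  have het2 : 0 < et ^ 2 := by positivity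
  have hkey := mul_neg_of_pos_of_neg het2 hsub
  have hring : (1.01 * et ^ 2) ^ 2 + (1.4 * et) ^ 2 * (1 / 10 ^ 20) ^ 2 + 2 * (1.01 * et ^ 2) * et
      - 2 * (1.4 * et) * (et / 10 * κ - et ^ 4) - 2 * (1.01 * et ^ 2) * (1.4 * et) * (-κ)
      = et ^ 2 * (1.0201 * et ^ 2 + 1.96 / 10 ^ 40 + 2.02 * et + 2.8 * et ^ 3 + 2.828 * (et * κ)
      - 0.28 * κ) := by ring
  linarith

/-- **The inference at (27) does not follow.**  Under the Case II hypotheses, if `κ = |⟨y'₁, T^j y'₁⟩|`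
satisfies `10⁻³⁷ ≤ κ ≤ 1/10` and `εθ ≤ κ/10`, then the coefficient vector
`a₀ = 1 + δ − 1.01 (εθ)²`, `a_j = 1.4 εθ · e^{iφ}`, all other `a_i = 0` (`δ = εθ/10`)
(i) has `ℓ²`-norm strictly below `1 + δ`, and (ii) lands strictly inside the ball of (26):
`‖x₀ − V a‖ < ‖x₀ − (1+δ) y'₁‖`.  Here `r = x₀ − (1+δ) y'₁`, `y = y'₁`, `w = e^{iφ} T^j y'₁`.
So `|a₀| < 1 + δ − (εθ)²` is attained with `|a_j| = 1.4 εθ < 1`, contradicting the printed sentence. [cite: Enflo2023, v2 p.13 (27)] -/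
theorem competitor_beats_scaling {r y w : H} (et κ : ℝ) (het : 0 < et) (hetκ : et ≤ κ / 10)
    (hκlo : 1 / 10 ^ 37 ≤ κ) (hκhi : κ ≤ 1 / 10) (hy : ‖y‖ ≤ 1) (hw : ‖w‖ ≤ 1 / 10 ^ 20)
    (hry : (⟪r, y⟫_ℂ).re ≤ et) (hrw : et / 10 * κ - et ^ 4 ≤ (⟪r, w⟫_ℂ).re)
    (hyw : ‖⟪y, w⟫_ℂ‖ ≤ κ) :
    ‖r + ((1.01 * et ^ 2 : ℝ) : ℂ) • y - ((1.4 * et : ℝ) : ℂ) • w‖ < ‖r‖ ∧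
      (1 + et / 10 - 1.01 * et ^ 2) ^ 2 + (1.4 * et) ^ 2 < (1 + et / 10) ^ 2 := by
  constructor
  · have hsq := norm_add_smul_sub_smul_sq r y w (1.01 * et ^ 2) (1.4 * et)
    have hA : ‖y‖ ^ 2 ≤ 1 := by nlinarith [norm_nonneg y]
    have hB : ‖w‖ ^ 2 ≤ (1 / 10 ^ 20) ^ 2 := pow_le_pow_left₀ (norm_nonneg w) hw 2
    have hs : |(⟪y, w⟫_ℂ).re| ≤ κ := (Complex.abs_re_le_norm _).trans hyw
    have hneg := competitor_scalar et κ (‖y‖ ^ 2) (‖w‖ ^ 2) (⟪r, y⟫_ℂ).re (⟪r, w⟫_ℂ).re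
      (⟪y, w⟫_ℂ).re het hetκ hκlo hκhi hA hB hry hrw hs
    have hlt : ‖r + ((1.01 * et ^ 2 : ℝ) : ℂ) • y - ((1.4 * et : ℝ) : ℂ) • w‖ ^ 2 < ‖r‖ ^ 2 := by
      rw [hsq]; linarith
    exact lt_of_pow_lt_pow_left₀ 2 (norm_nonneg _) hlt
  · have het01 : et ≤ 1 / 100 := by linarith
    have h2 : et ^ 2 ≤ (1 / 100) ^ 2 := by nlinarith
    have h4 : 1.0201 * et ^ 4 ≤ 1.0201 * (1 / 100) ^ 2 * et ^ 2 := by nlinarith [sq_nonneg et]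
    have h3 : 0 < et ^ 3 := by positivity
    nlinarith [sq_nonneg et]

end Literature.Analysis.OperatorTheory.Enflo2023.Referee
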